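import Mathlib
import HarnessLib

/-!
# TwoNotchStaticConveyor — the u-channel identity of the t-STATIC regime, the single-speed no-go, the flux sign law
# and the weighted channel sum (STAGING; nogo gen 20, `PBOOK-ADDENDUM-3.md` §2 and §4, pen lemmas TS4–TS7)

search for candidate a priori estimates; no regularity claim.

Setting (prose dictionary, ADDENDUM-3 §1–§2; the p = 1 PERMISSIVE two-notch K book, sizes `d > t > u > 0`, chords moving with
`dx/dy = −T(mid-state)` for a velocity law `T` strictly increasing — the book: `T = tan`).  In the t-STATIC regime (a y-periodic orbit with no
t-event) the t-skeleton `P (−t +t)^a M (+t −t)^b` is frozen and sign-alternating (TS1), and: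
* TS4 (i) INERTIA — a pair birth/death changes the two director values adjacent to its HOST and nothing else, so every u-chord keeps its birth
  velocity until it dies, and a skeleton chord changes velocity only at its own events;
* TS4 (ii) CHANNELS — every gap between consecutive skeleton chords is a FIFO channel, fed by pair births at its minus end `h` (heights
  `e₁ < e₂ < …`, period `Y`) and emptied by pair deaths at its plus end `h′` (heights `g₁ < g₂ < …`); by FIFO the p-th particle runs from
  `(x_h(e_p), e_p)` to `(x_{h′}(g_p), g_p)` at constant velocity `c_p`:  `x_{h′}(g_p) = x_h(e_p) + c_p · L_p`, `L_p = g_p − e_p`;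
* between consecutive own events a host's velocity is constant: `x_h(e_{p+1}) − x_h(e_p) = vM_p · δM_p`, `x_{h′}(g_{p+1}) − x_{h′}(g_p) = vT_p · δT_p`,
  `L_{p+1} − L_p = δT_p − δM_p`, and over one period `Σ_p δM_p = Σ_p δT_p = Y`;
* TS4 (iv) ORDER (from `d > t > u` and monotone `T` only, `order_R_channel` / `order_L_channel` below): in a channel whose two hosts have DIFFERENT
  sizes (`M → +t`, `−t → P`, `P ← −t`, `+t ← M`; every loaded skeleton has one) the products `(vT_p − vM_p)(c_{p+1} − vT_p)` have one strict
  sign for all `p`.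
What is kernel-checked here (all elementary, `[ours]`):
* `channel_identity` — (⋆) `(vT_p − vM_p) δM_p = (c_{p+1} − c_p) L_p + (c_{p+1} − vT_p)(δT_p − δM_p)` from the four bookkeeping lines above
  (the successor map `σ` is arbitrary: no cyclic-order facts are used);
* `increment_pos` / `increment_neg` — in a SINGLE-SPEED channel (`c_{p+1} = c_p`) every lifetime increment `δT_p − δM_p` has the sign of the ORDER product;
* `no_orbit_single_speed` — hence `Σ δT ≠ Σ δM`: contradiction with one period of each host.  THIS IS TS5: no t-static y-periodic orbit with a
  loaded skeleton exists in which the u-particles of some unequal channel share one speed — in particular NONE in which every skeleton chord has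
  exactly two events per period (levels {0,1}: all particles carry the label 1/2), for every tilt and every strictly increasing law; this is the
  whole frozen-skeleton class (L_max 10, B 2, ≤ 12 events) of ADDENDUM-3 §3 (3 296 / 3 296 cycles, engine verdict LP-EMPTY at stage 1, IIS table §3.2);
* `order_R_channel`, `order_L_channel` — the ORDER facts for the model mids;
* TS6 (ADDENDUM-3 §4a) `bottom_pair_lt` / `bottom_pair_gt` / `ratio_coeff_lt` / `flux_sign` / `no_zero_flux` — the FLUX SIGN LAW of the two
  equal channels at a bottom crossing (zero kill-pairing flux is dead on `[P, M, +t, −t]` and `[P, −t, +t, M]`);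
* TS7 (ADDENDUM-3 §4c) `weighted_channel_sum` / `no_orbit_weighted` / `no_orbit_weighted'` / `exists_pos_step` / `weight_ratio_reciprocal` /
  `weight_factor_pos` — the WEIGHTED CHANNEL SUM: in any unequal channel, with positive consistent weights, the weighted source step durations
  sum to zero, so no t-static y-periodic orbit exists on ANY loaded skeleton (every label content, every word, tilt and strictly increasing law);
  the existence of the positive consistent weights (closed-walk product = 1 from `weight_ratio_reciprocal`, sign from `weight_factor_pos`) is pen.
NOT checked by Lean: that the bookkeeping lines ARE the kinematics of the book (pen TS4, ADDENDUM-3 §2, cross-checked against the engine of record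
`korbit/morbit.py` in §3 and §4b(v)), the common crossing word TS4 (iv), and the weight combinatorics of TS7.  Nothing is claimed about Navier–Stokes.
-/

namespace Summit.NavierStokesRegularity.FunctionalMining.TwoNotchStaticConveyor

open Finset

variable {n : ℕ}

/-- (⋆) the CHANNEL IDENTITY.  `aM p` / `aT p` = position of the minus / plus host at the p-th emission / absorption, `L p` = lifetime and
`c p` = velocity of the p-th particle, `vM p`, `vT p` = host velocities and `δM p`, `δT p` = durations between the p-th and the next own event,
`σ` = "next particle" (any map). -/
theorem channel_identity (σ : Fin n → Fin n) (aM aT L c vM vT δM δT : Fin n → ℝ)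
    (hpart : ∀ p, aT p = aM p + c p * L p)
    (hM : ∀ p, aM (σ p) - aM p = vM p * δM p)
    (hT : ∀ p, aT (σ p) - aT p = vT p * δT p)
    (hL : ∀ p, L (σ p) - L p = δT p - δM p) (p : Fin n) :
    (vT p - vM p) * δM p = (c (σ p) - c p) * L p + (c (σ p) - vT p) * (δT p - δM p) := by
  linear_combination (-1 : ℝ) * hpart p + hpart (σ p) + hM p - hT p + c (σ p) * hL p

/-- Single-speed channel, ORDER product positive ⇒ every lifetime increment is positive. -/
theorem increment_pos (σ : Fin n → Fin n) (aM aT L c vM vT δM δT : Fin n → ℝ)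
    (hpart : ∀ p, aT p = aM p + c p * L p) (hM : ∀ p, aM (σ p) - aM p = vM p * δM p)
    (hT : ∀ p, aT (σ p) - aT p = vT p * δT p) (hL : ∀ p, L (σ p) - L p = δT p - δM p)
    (hc : ∀ p, c (σ p) = c p) (hδM : ∀ p, 0 < δM p)
    (hs : ∀ p, 0 < (vT p - vM p) * (c p - vT p)) (p : Fin n) : 0 < δT p - δM p := by
  have hid : (vT p - vM p) * δM p = (c p - vT p) * (δT p - δM p) := by
    have h := channel_identity σ aM aT L c vM vT δM δT hpart hM hT hL p
    rw [hc p] at h; linear_combination h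
  by_contra hle
  have hle' : δT p - δM p ≤ 0 := not_lt.mp hle
  have h2 : 0 < (vT p - vM p) * (c p - vT p) * δM p := mul_pos (hs p) (hδM p)
  have h3 : (vT p - vM p) * δM p * (c p - vT p) = (c p - vT p) * (δT p - δM p) * (c p - vT p) := by rw [hid]
  nlinarith [mul_nonpos_of_nonneg_of_nonpos (sq_nonneg (c p - vT p)) hle', h2, h3]

/-- Single-speed channel, ORDER product negative ⇒ every lifetime increment is negative. -/
theorem increment_neg (σ : Fin n → Fin n) (aM aT L c vM vT δM δT : Fin n → ℝ)
    (hpart : ∀ p, aT p = aM p + c p * L p) (hM : ∀ p, aM (σ p) - aM p = vM p * δM p)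
    (hT : ∀ p, aT (σ p) - aT p = vT p * δT p) (hL : ∀ p, L (σ p) - L p = δT p - δM p)
    (hc : ∀ p, c (σ p) = c p) (hδM : ∀ p, 0 < δM p)
    (hs : ∀ p, (vT p - vM p) * (c p - vT p) < 0) (p : Fin n) : δT p - δM p < 0 := by
  have hid : (vT p - vM p) * δM p = (c p - vT p) * (δT p - δM p) := by
    have h := channel_identity σ aM aT L c vM vT δM δT hpart hM hT hL p
    rw [hc p] at h; linear_combination h
  by_contra hle
  have hle' : 0 ≤ δT p - δM p := not_lt.mp hle
  have h2 : (vT p - vM p) * (c p - vT p) * δM p < 0 := mul_neg_of_neg_of_pos (hs p) (hδM p)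
  have h3 : (vT p - vM p) * δM p * (c p - vT p) = (c p - vT p) * (δT p - δM p) * (c p - vT p) := by rw [hid]
  nlinarith [mul_nonneg (sq_nonneg (c p - vT p)) hle', h2, h3]

/-- TS5 — THE SINGLE-SPEED NO-GO.  A channel of the frozen skeleton whose hosts have different sizes (ORDER product of one strict sign) and whose
particles share one speed cannot be run periodically: the lifetime increments all have one sign, yet they telescope to `Σ δT − Σ δM = Y − Y = 0`.
In particular no t-static y-periodic orbit with a loaded skeleton has exactly two events per period at its skeleton chords. -/
theorem no_orbit_single_speed (hn : 0 < n) (σ : Fin n → Fin n) (aM aT L c vM vT δM δT : Fin n → ℝ)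
    (hpart : ∀ p, aT p = aM p + c p * L p) (hM : ∀ p, aM (σ p) - aM p = vM p * δM p)
    (hT : ∀ p, aT (σ p) - aT p = vT p * δT p) (hL : ∀ p, L (σ p) - L p = δT p - δM p)
    (hc : ∀ p, c (σ p) = c p) (hδM : ∀ p, 0 < δM p)
    (hs : (∀ p, 0 < (vT p - vM p) * (c p - vT p)) ∨ (∀ p, (vT p - vM p) * (c p - vT p) < 0))
    (hperiod : ∑ p, δT p = ∑ p, δM p) : False := by
  have hne : (Finset.univ : Finset (Fin n)).Nonempty := ⟨⟨0, hn⟩, Finset.mem_univ _⟩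
  have hsumD : ∑ p, (δT p - δM p) = 0 := by rw [Finset.sum_sub_distrib]; linarith
  rcases hs with hs | hs
  · have hpos : 0 < ∑ p, (δT p - δM p) :=
      Finset.sum_pos (fun p _ => increment_pos σ aM aT L c vM vT δM δT hpart hM hT hL hc hδM hs p) hne
    linarith
  · have hneg : 0 < ∑ p, (δM p - δT p) :=
      Finset.sum_pos (fun p _ => by
        have := increment_neg σ aM aT L c vM vT δM δT hpart hM hT hL hc hδM hs p; linarith) hne
    have : ∑ p, (δM p - δT p) = -(∑ p, (δT p - δM p)) := by
      rw [← Finset.sum_neg_distrib]; exact Finset.sum_congr rfl (fun p _ => by ring)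
    linarith

/-- ORDER facts, rightward (low) channel `h → h′` at director level `ℓ`: minus host of size `A` (mid `ℓ + A/2 + k u`), plus host of size `B`
(mid `ℓ + B/2 + k u`), particle label `1/2` (mid `ℓ + u/2`); with `u < B < A` (channel `M → +t`: A = d, B = t) and `k ≥ 0`:
`vM < vT < c`, so the ORDER product is positive.  (For `u < A < B`, channel `−t → P`, the first inequality flips: product negative.) -/
theorem order_R_channel {T : ℝ → ℝ} (hT : StrictMono T) {A B u ℓ k : ℝ}
    (hBA : B < A) (huB : u < B) (hu : 0 < u) (hk : 0 ≤ k) :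
    -T (ℓ + A / 2 + k * u) < -T (ℓ + B / 2 + k * u) ∧ -T (ℓ + B / 2 + k * u) < -T (ℓ + u / 2) := by
  refine ⟨?_, ?_⟩
  · have h : ℓ + B / 2 + k * u < ℓ + A / 2 + k * u := by linarith
    have := hT h; linarith
  · have h : ℓ + u / 2 < ℓ + B / 2 + k * u := by nlinarith
    have := hT h; linarith

/-- ORDER facts, leftward (high) channel `h′ ← h` at director level `ℓ` (the level between the particle and its hosts' high sides): plus host of
size `B` at the left end (mid `ℓ − B/2 + k u`), minus host of size `A` at the right end (mid `ℓ − A/2 + k u`), particle label `1/2` (mid `ℓ + u/2`),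
`k ≤ 1` (levels {0,1}); with `A < B` (channel `P ← −t`: B = d, A = t): `vM < vT` and `c < vT`, so the ORDER product is negative.
(For `B < A`, channel `+t ← M`, the first inequality flips: product positive.) -/
theorem order_L_channel {T : ℝ → ℝ} (hT : StrictMono T) {A B u ℓ k : ℝ}
    (hAB : A < B) (hu : 0 < u) (hk : k ≤ 1) (huA : u < A) :
    -T (ℓ - A / 2 + k * u) < -T (ℓ - B / 2 + k * u) ∧ -T (ℓ + u / 2) < -T (ℓ - B / 2 + k * u) := by
  refine ⟨?_, ?_⟩
  · have h : ℓ - B / 2 + k * u < ℓ - A / 2 + k * u := by linarith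
    have := hT h; linarith
  · have h : ℓ - B / 2 + k * u < ℓ + u / 2 := by nlinarith
    have := hT h; linarith


/-! ## TS6 — the flux sign law (PBOOK-ADDENDUM-3 §4a)

For `N ≥ 2` the common host walk has two consecutive up-steps at its minimum (`↑↑`); the per-crossing closure of
the four particle segments of one label gives, at those two crossings, `a₀ x + b₀ y = R₀` and `a₁ x + b₁ y = R₁`
for the two equal-channel lifetimes `x, y` of the first crossing, with `R₁ - R₀ = Q · Y · (c(3/2) - c(1/2))`,
`Q` the integer flux.  The two elementary comparisons below (pure monotonicity of the law `T`, points
`p < r < q < s < w`) give `a₁ < a₀, b₁ < b₀` on the skeleton `[P, M, +t, -t]` (`bottom_pair_lt`, in the divided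
form `ratio_coeff_lt`) and `a₁ > a₀, b₁ > b₀` on `[P, -t, +t, M]` (`bottom_pair_gt`); `flux_sign` then forces
`R₁ < R₀` (resp. `R₀ < R₁`), i.e. a non-zero flux of a definite sign, and `no_zero_flux` records that the
index-preserving (zero-flux) pairing admits no orbit. -/

/-- `(T s − T q)(T w − T r) < (T w − T q)(T s − T p)` for `p < r < q < s < w`:
with `A = T r − T p`, `B = T q − T r`, `C = T s − T q`, `D = T w − T s` the difference is `C A + D A + D B > 0`. -/
theorem bottom_pair_lt {T : ℝ → ℝ} (hT : StrictMono T) {p r q s w : ℝ}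
    (hpr : p < r) (hrq : r < q) (hqs : q < s) (hsw : s < w) :
    (T s - T q) * (T w - T r) < (T w - T q) * (T s - T p) := by
  have hA : 0 < T r - T p := sub_pos.mpr (hT hpr)
  have hB : 0 < T q - T r := sub_pos.mpr (hT hrq)
  have hC : 0 < T s - T q := sub_pos.mpr (hT hqs)
  have hD : 0 < T w - T s := sub_pos.mpr (hT hsw)
  nlinarith [mul_pos hC hA, mul_pos hD hA, mul_pos hD hB]

/-- `(T q − T r)(T s − T p) < (T q − T p)(T w − T r)` for `p < r < q < s < w`:
the difference is `A C + A D + B D > 0` in the same notation. -/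
theorem bottom_pair_gt {T : ℝ → ℝ} (hT : StrictMono T) {p r q s w : ℝ}
    (hpr : p < r) (hrq : r < q) (hqs : q < s) (hsw : s < w) :
    (T q - T r) * (T s - T p) < (T q - T p) * (T w - T r) := by
  have hA : 0 < T r - T p := sub_pos.mpr (hT hpr)
  have hB : 0 < T q - T r := sub_pos.mpr (hT hrq)
  have hC : 0 < T s - T q := sub_pos.mpr (hT hqs)
  have hD : 0 < T w - T s := sub_pos.mpr (hT hsw)
  nlinarith [mul_pos hA hC, mul_pos hA hD, mul_pos hB hD]

/-- Divided form used in the text: the second-crossing coefficient `ρ · a(3/2)` with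
`ρ = (T s − T q)/(T w − T q)` and `a(3/2) = T w − T r` is smaller than `a(1/2) = T s − T p`. -/
theorem ratio_coeff_lt {T : ℝ → ℝ} (hT : StrictMono T) {p r q s w : ℝ}
    (hpr : p < r) (hrq : r < q) (hqs : q < s) (hsw : s < w) :
    (T s - T q) / (T w - T q) * (T w - T r) < T s - T p := by
  have hwq : 0 < T w - T q := sub_pos.mpr (hT (hqs.trans hsw))
  rw [div_mul_eq_mul_div, div_lt_iff₀ hwq, mul_comm (T s - T p)]
  exact bottom_pair_lt hT hpr hrq hqs hsw

/-- TS6, sign law: smaller coefficients at the second crossing and positive lifetimes force `R₁ < R₀`. -/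
theorem flux_sign {a₀ b₀ a₁ b₁ x y R₀ R₁ : ℝ} (h₀ : a₀ * x + b₀ * y = R₀) (h₁ : a₁ * x + b₁ * y = R₁)
    (ha : a₁ < a₀) (hb : b₁ < b₀) (hx : 0 < x) (hy : 0 < y) : R₁ < R₀ := by
  nlinarith [mul_lt_mul_of_pos_right ha hx, mul_lt_mul_of_pos_right hb hy]

/-- TS6, zero flux: with `R₀ = R₁` (flux `Q = 0`: all four kill pairings index-preserving) the two
equal-channel lifetimes of the first bottom crossing cannot both be positive — no orbit. -/
theorem no_zero_flux {a₀ b₀ a₁ b₁ x y R : ℝ} (h₀ : a₀ * x + b₀ * y = R) (h₁ : a₁ * x + b₁ * y = R)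
    (ha : a₁ < a₀) (hb : b₁ < b₀) (hx : 0 < x) (hy : 0 < y) : False :=
  lt_irrefl R (flux_sign h₀ h₁ ha hb hx hy)

/-! ## TS7 — the WEIGHTED CHANNEL SUM (source-monotonicity no-go)

In ONE channel of a frozen skeleton (source `S`, sink `K`, both performing the common crossing word, particle `i` born at
`S`-event `i` and absorbed at `K`-event `σ i`; straight worldline pieces) the step closure gives, for every `i`,
`(v_K(k_i) − v_S(k_i)) · Δ^S_i = (c_{σ i} − v_K(k_i)) · τ_{σ i} − (c_i − v_K(k_i)) · τ_i`   — abstractly `g i * Δ i = P' i * τ (σ i) − P i * τ i`.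
Because a closed walk traverses every edge of the level graph equally often upward and downward, positive WEIGHTS with
`w (σ i) * P (σ i) = w i * P' i` exist (pen, §4c of PBOOK-ADDENDUM-3); then the weighted sum of the source's step durations vanishes
identically, which is absurd when `g` has one strict sign (unequal channel: chord types d ≠ t) and every step duration is positive. -/

/-- TS7 core identity: with consistent weights the weighted source steps telescope to zero (σ any permutation of the labels). -/
theorem weighted_channel_sum (σ : Equiv.Perm (Fin n)) (g Δ P P' τ w : Fin n → ℝ)
    (hI : ∀ i, g i * Δ i = P' i * τ (σ i) - P i * τ i)
    (hw : ∀ i, w (σ i) * P (σ i) = w i * P' i) :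
    ∑ i, w i * (g i * Δ i) = 0 := by
  have h1 : ∀ i, w i * (g i * Δ i) = w (σ i) * P (σ i) * τ (σ i) - w i * P i * τ i := by
    intro i; rw [hI i, mul_sub, ← mul_assoc, ← hw i]; ring
  simp_rw [h1]
  rw [Finset.sum_sub_distrib, Equiv.sum_comp σ (fun i => w i * P i * τ i)]
  ring

/-- TS7: no t-static orbit has an unequal channel — one strict sign of `g = v_K − v_S`, positive weights, positive source steps. -/
theorem no_orbit_weighted (hn : 0 < n) (σ : Equiv.Perm (Fin n)) (g Δ P P' τ w : Fin n → ℝ)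
    (hI : ∀ i, g i * Δ i = P' i * τ (σ i) - P i * τ i)
    (hw : ∀ i, w (σ i) * P (σ i) = w i * P' i) (hwpos : ∀ i, 0 < w i)
    (hg : (∀ i, 0 < g i) ∨ (∀ i, g i < 0)) (hΔ : ∀ i, 0 < Δ i) : False := by
  have hne : (Finset.univ : Finset (Fin n)).Nonempty := ⟨⟨0, hn⟩, Finset.mem_univ _⟩
  have h0 := weighted_channel_sum σ g Δ P P' τ w hI hw
  rcases hg with hg | hg
  · have hpos : 0 < ∑ i, w i * (g i * Δ i) :=
      Finset.sum_pos (fun i _ => mul_pos (hwpos i) (mul_pos (hg i) (hΔ i))) hne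
    linarith
  · have hneg : 0 < ∑ i, -(w i * (g i * Δ i)) :=
      Finset.sum_pos (fun i _ => by
        have : w i * (g i * Δ i) < 0 := mul_neg_of_pos_of_neg (hwpos i) (mul_neg_of_neg_of_pos (hg i) (hΔ i))
        linarith) hne
    rw [Finset.sum_neg_distrib] at hneg
    linarith

/-- TS7 with WEAKLY positive source steps (the engine's order rows allow consecutive events of one host to coincide):
it suffices that every step is `≥ 0` and one step is `> 0` (their sum is the period `Y > 0`). -/
theorem no_orbit_weighted' (σ : Equiv.Perm (Fin n)) (g Δ P P' τ w : Fin n → ℝ)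
    (hI : ∀ i, g i * Δ i = P' i * τ (σ i) - P i * τ i)
    (hw : ∀ i, w (σ i) * P (σ i) = w i * P' i) (hwpos : ∀ i, 0 < w i)
    (hg : (∀ i, 0 < g i) ∨ (∀ i, g i < 0)) (hΔ : ∀ i, 0 ≤ Δ i) (hΔ' : ∃ i, 0 < Δ i) : False := by
  have h0 := weighted_channel_sum σ g Δ P P' τ w hI hw
  obtain ⟨i₀, hi₀⟩ := hΔ'
  rcases hg with hg | hg
  · have hpos : 0 < ∑ i, w i * (g i * Δ i) :=
      Finset.sum_pos' (fun i _ => mul_nonneg (hwpos i).le (mul_nonneg (hg i).le (hΔ i)))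
        ⟨i₀, Finset.mem_univ _, mul_pos (hwpos i₀) (mul_pos (hg i₀) hi₀)⟩
    linarith
  · have hneg : 0 < ∑ i, -(w i * (g i * Δ i)) :=
      Finset.sum_pos' (fun i _ => by
        have : w i * (g i * Δ i) ≤ 0 := mul_nonpos_of_nonneg_of_nonpos (hwpos i).le (mul_nonpos_of_nonpos_of_nonneg (hg i).le (hΔ i))
        linarith)
        ⟨i₀, Finset.mem_univ _, by
          have : w i₀ * (g i₀ * Δ i₀) < 0 := mul_neg_of_pos_of_neg (hwpos i₀) (mul_neg_of_neg_of_pos (hg i₀) hi₀)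
          linarith⟩
    rw [Finset.sum_neg_distrib] at hneg
    linarith

/-- Period bookkeeping used with `no_orbit_weighted'`: nonnegative steps summing to a positive period have a positive step. -/
theorem exists_pos_step (Δ : Fin n → ℝ) {Y : ℝ} (hY : 0 < Y) (hsum : ∑ i, Δ i = Y) : ∃ i, 0 < Δ i := by
  by_contra h
  have : ∑ i, Δ i ≤ 0 := Finset.sum_nonpos (fun i _ => not_lt.mp (fun hi => h ⟨i, hi⟩))
  linarith

/-- TS7, the two-level weight ratio is reciprocal under reversing the step (edge `a → a+1` vs `a+1 → a`):
`H(a, a+1) · H(a+1, a) = 1` for `H(k, k') = (c − v k)/(c − v k')` with `c = c((k+k')/2)`; hence the weight product around a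
closed walk is 1 (pen: every edge is traversed equally often in both directions). -/
theorem weight_ratio_reciprocal {c vk vk' : ℝ} (hk : c - vk ≠ 0) (hk' : c - vk' ≠ 0) :
    (c - vk) / (c - vk') * ((c - vk') / (c - vk)) = 1 := by
  rw [div_mul_div_comm, mul_comm (c - vk') (c - vk), div_self (mul_ne_zero hk hk')]

/-- TS7, sign of the weight factors: the sink (or source) chord of half-width `B/2 > u/2` at level `k` versus the adjacent
labels `k ± 1/2`: `c(k − 1/2) − v(k)` and `c(k + 1/2) − v(k)` are both positive (`T` strictly increasing), so the weights are positive. -/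
theorem weight_factor_pos {T : ℝ → ℝ} (hT : StrictMono T) {B u ℓ k : ℝ} (hu : 0 < u) (huB : u < B) :
    0 < T (ℓ + B / 2 + k * u) - T (ℓ + (k + 1 / 2) * u) ∧ 0 < T (ℓ + B / 2 + k * u) - T (ℓ + (k - 1 / 2) * u) := by
  constructor
  · exact sub_pos.mpr (hT (by nlinarith))
  · exact sub_pos.mpr (hT (by nlinarith))

end Summit.NavierStokesRegularity.FunctionalMining.TwoNotchStaticConveyor
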